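import Literature.NumberTheory.GelbartRogawski1991.UnitaryDualPairWeilCoinvariantsSmooth
import Literature.NumberTheory.GelbartRogawski1991.UnitaryDualPairWeilCoinvariantsCenter
import Literature.NumberTheory.QuadraticForms.QuadraticNormIndex
import HarnessLib

/-!
# [Liu2021, Def. 4.11]'s oscillator carriers `(ε, χ) ↦ ω(μ, ε, χ)` modelled on the GR91 Weil `χ`-coinvariants

Topic `NumberTheory/Automorphic/Liu2021`; namespace `Literature.NumberTheory.Automorphic.Liu2021.Def411WeilCarriers`.
KERNEL ONLY: definitions and theorems, 0 records, 0 named facts, 0 `sorry`.  Nothing of [Liu2021] is asserted.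

[Liu2021, Def. 4.11 (`FJcycle.tex` l. 2083–2097)]: an *adèlic oscillator triple* `(μ, ε, χ)` consists of a conjugate
symplectic automorphic character `μ` of `𝔸_E^×`, «a collection `ε = (ε_v ∈ E_v^{−×}/Nm_{E_v/F_v}E_v^×)_v` for every
nonarchimedean place `v` of `F` such that `ε_v ∈ O_{E_v}^× Nm_{E_v/F_v} E_v^×` for all but finitely many `v`», and «an
automorphic character `χ = ⊗χ_v : E¹\(𝔸_E^∞)¹ → ℂ^×`»; `ω(μ, ε, χ) := ⊗'_v ω(μ_v, ε_v, χ_v)`, where (App. D §D.1 Steps 1–3,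
l. 5214–5221) `ω(μ_v, ε_v, χ_v)` is the maximal quotient, on which the centre `E_v¹` acts by `χ_v`, of the Weil
representation `ω(ε_v)` of `Mp(V_{ε_v})` (`V_ε = Res_{E/F} V` with the form `Tr_{E/F} ε( , )_V`) restricted to `U(V)(F_v)`
along the splitting `ι_{μ_v}` ([HKS96, §1]).  [Liu2021, Def. 4.12 (l. 2102–2108)]: `ε` is `μ`-admissible iff
`ε_v = e·Nm_{E_v/F_v}E_v^×` for all `v` for one GLOBAL `e ∈ E^{×−}` (with a sign condition at `Φ_μ`).

This file types the three carriers `Eps ∋ ε`, `Chi ∋ χ`, `omega ε χ` (with its `𝔾(𝔸_F^∞)`-action `rho ε χ`) in the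
currency of the tree's finite-adelic unitary dual pair `U(J_V) × U(J_W) ⊆ U(J_V ⊗ J_W) = G₁` of
[GelbartRogawski1991, §3.1] (`UnitaryDualPairWeilCoinvariants*.lean`), for a hermitian space `V` of rank `N` with a
DIAGONALISABLE Gram matrix `J_V = T_V ⊗ 1` (`T_V` symmetric over `F`, the lane's standing convention) and the hermitian
LINES `W = ⟨a⟩`, `a ∈ F^×` — exactly in the shape of the five `ω`-side fields `Eps / epsOf / Chi / omega / rho` of
`Liu2021.AppendixC.Thm418Rest` (`AppendixC/Glue.lean`) resp. of `Liu2021.Thm418Data` (`Thm418AsPrinted.lean`):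

* **`Eps F d`** = `Π_v (F_v^× / Nm_{E_v/F_v} E_v^×)`, `v` over `HeightOneSpectrum (𝓞 F)`, `E_v = F_v[√d]`, `d = δ²` for the
  lane's fixed `δ ∈ E^{×−}` (`c δ = −δ`): the dictionary `ε_v ↦ ε_v / δ` identifies `E_v^{−×}/Nm E_v^×` with `F_v^×/Nm E_v^×`
  (`E_v^{−×} = δ · F_v^×`), so a collection IS a point of `Eps F d` and «equality in `Eps` = equality of collections»
  (the demand of the `Thm418Data.Eps` docstring).  Liu's restriction «`ε_v` in the unit class for almost all `v`» holds
  on the image of `E^{×−}` (a global `a ∈ F^×` is a unit and `d` a non-dyadic unit at almost all `v`, where units are norms: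
  `QuadraticForms.mem_quadraticNormSubgroup_of_valued_eq_one`) and is invisible to [Liu2021, Thm. 4.18], which reads `Eps`
  only through the `μ`-ADMISSIBLE `ε`, all of the form `epsOf e`; it is therefore not imposed on the type.
* **`epsOf e`** = the collection of `e ∈ E^{×−}`: the classes of the `F`-part `½·Tr_{E/F}(e/δ) ∈ F` of `e/δ` (for
  `e ∈ E^{×−}`, `e/δ ∈ F` and this is `e/δ` itself); off `E^{×−}` the value is junk and never read (docstring of
  `Thm418Data.epsOf`).  `lineOf ε ∈ F^×` is a global representative of a global collection (`locF_lineOf`).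
  CONVENTION (to be checked ONCE by the instantiator against the sign it needs): the dual-pair lane's symplectic space for
  the pair `(V, ⟨a⟩)` is `Res_{E/F}(V ⊗ ⟨a⟩)` with the form `Tr_{E/F}(δ·a·h_V)` («the skew-hermitian form is `δ·h`»,
  `UnitaryDualPairSplittingDatum.lean` header, `CompatibleSplitting.lean` object-match (c)), so Liu's `V_e = (Res V,
  Tr_{E/F} e·( , )_V)` (App. D Step 1) is the pair `(V, ⟨e/δ⟩)` — whence `e/δ`, not `e·δ` (the two differ by the class
  of `d = δ²`, totally negative, which would exchange the `μ`-admissible family of Def. 4.12 with an inadmissible one);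
  a totally positive global rescaling of the form (a factor `2` of a polarisation, a `ψ`-normalisation) only permutes
  the admissible collections among themselves and re-indexes the family.
* **`Chi F E c`** = the automorphic characters of `E¹\(𝔸_E^∞)¹`: continuous characters of the norm-one finite idèles
  `UnitaryGroup.finAdelicOne F E c = U(1)(𝔸_{F,f})` trivial on the rational norm-one elements `E¹ = U(1)(F)`; ONE type for
  all lines, moved to the line's unitary group `U(J_W)(𝔸_{F,f})` by the inverse of the tree's (bijective, for lines)
  `UnitaryGroup.finAdelicCenter F E c 1 J_W` (`lineChar`, `lineChar_finAdelicCenter`).  `Inhabited (Chi F E c)` (the trivial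
  character) is [Liu2021, Thm. 4.18]'s reading `hChi : Nonempty Chi` of the consumer.
* **`omega … ε χ`** = the `χ`-coinvariants `Ω(s, χ_W)` of the finite Weil representation of the pair `(V, ⟨lineOf ε⟩)`
  under `U(J_W)(𝔸_{F,f}) = E¹(𝔸_f)` (`WeilCoinv.weilCoinv`, [Liu2021, App. D Step 3]: inside `G₁` the centre `u·1_V` of `U(J_V)`
  and `u·1_W ∈ U(J_W)` COINCIDE — `UnitaryGroup.adelicInl_finAdelicCenter_eq_adelicInr_finAdelicCenter` — so Liu's «maximal
  quotient with central character `χ`» of `ω(ε)∘ι|_{U(V)}` is this coinvariant space: `rhoV_finAdelicCenter`), and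
  **`rho … ι ε χ`** = its `U(J_V)(𝔸_{F,f})`-action pulled back along a continuous `ι : G →* U(J_V)(𝔸_{F,f})` (the consumer's
  `𝔾(𝔸_F^∞) = C.G`; at the Appendix-C datum of a rank-3 hermitian space over a CM field `C.G` IS
  `↥(UnitaryGroup.finAdelic L⁺ L c̄ 3 Hm)` and `ι` is a `UnitaryGroup.finAdelicCongr` to a diagonal Gram matrix).
* **`rho_smooth`**: `ω(μ, ε, χ)` is SMOOTH — `∀ v, ∃ S ≤ G` open, `∀ k ∈ S, rho ε χ k v = v` — token for token the reading
  `hsm` of [Liu2021, Def. 4.11 «admissible»] consumed next to Thm. 4.18, now a theorem (`WeilCoinv.weilCoinv_comp_smooth`).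

THE SPLITTING IS A PARAMETER (what this file does NOT choose).  Liu's `ω(μ, ε, χ)` restricts the Weil representation
along the splitting `ι_μ` DETERMINED BY `μ` (App. D Step 2, [HKS96, §1]); the tree's [GelbartRogawski1991, Prop. 3.1.1]
(`SplittingDatum.CompatibleSplitting`) is an existential over all compatible splittings `s : G₁(𝔸_F) → Mp`, and two of
them differ by an automorphic character `ν ∘ det`, which twists the whole family `{Ω(s, χ)}_χ` by `ν ∘ det_V` as
`U(J_V)(𝔸_{F,f})`-modules (inside one `ε` a central twist `s ↦ s ⊗ ĉ` merely re-indexes `χ ↦ χ·ĉ_W`: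
`WeilCoinv.weilCoinvTwistEquiv`).  Since the `M_μ[𝔾(𝔸_F^∞)]`-module `Ω(μ)` of Thm. 4.18 is fixed, the theorem as printed
concerns `s_ε|_{U(V)} = ι_μ`: accordingly every carrier below takes the family `s = (s_a)_{a ∈ F^×}` of compatible, continuous
pair splittings as an ARGUMENT (`s`, `hs`, `hsc`), to be instantiated by the splitting attached to `μ`; nothing is hidden
behind `Exists.choose` in §3 (§4 offers, separately and so labelled, the MODEL-CHOICE variant `omegaGR`/`rhoGR` on the lane's
chosen splittings `splittingOf` under a family `hGR` of cited [GelbartRogawski1991, Prop. 3.1.1] existentials, for a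
consumer who wants ONE cited binder; smoothness and the central character hold for any choice).  NOT CLAIMED here: irreducibility of `ω(μ, ε, χ)` ([Liu2021, Lem. D.1 (1)], `LemD1AsPrinted.lean`),
the `⊗'` structure (`FinLocalSplittings.omegaPi_centralCoinv`, `FiniteAdelicWeilCentralCoinvariants.lean`, on the
place-assembled carrier), non-vanishing, admissibility beyond smoothness.  HC_CM is not mentioned by this file.

## References
* [Liu2021] Y. Liu, *Fourier–Jacobi cycles and arithmetic relative trace formula*, Camb. J. Math. 9 (2021) =
  arXiv:2102.11518: Def. 4.11 (l. 2083–2097), Def. 4.12 (l. 2102–2108), App. D §D.1 Steps 1–3 (l. 5214–5221),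
  Lem. D.1 (l. 5226–5233), Thm. 4.18 (l. 2232–2245).
* [GelbartRogawski1991] S. Gelbart, J. Rogawski, *L-functions and Fourier–Jacobi coefficients for the unitary group
  U(3)*, Invent. Math. 105 (1991), §3.1 p. 454 (dual pair, centre), Prop. 3.1.1 p. 455, Remark p. 457.
* [HKS96] M. Harris, S. Kudla, W. Sweet, *Theta dichotomy for unitary groups*, J. AMS 9 (1996), §1 (the splittings
  `ι_χ : U(V) → Mp(W)` determined by a character `χ` with `χ|_{F^×} = ε_{E/F}^{dim}`).
* [Mok2014] C. P. Mok, Mem. AMS 235 (2015), §1 Notation p. 5 (`U(1)` = centre of `U(N)`).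
* [Omeara1963] O. T. O'Meara, *Introduction to quadratic forms*, §63, §65A (local norm groups of quadratic extensions).
-/

noncomputable section

open NumberField IsDedekindDomain
open scoped Kronecker
open Literature.NumberTheory Literature.NumberTheory.Automorphic
open Literature.NumberTheory.GelbartRogawski1991 Literature.NumberTheory.GelbartRogawski1991.UnitaryDualPair
open Literature.NumberTheory.GelbartRogawski1991.UnitaryDualPair.WeilCoinv
open Literature.NumberTheory.Weil1964 Literature.RepresentationTheory

namespace Literature.NumberTheory.Automorphic.Liu2021.Def411WeilCarriers

/-! ## §1. `ε`: collections of local norm classes, and the collection of a global element -/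

section Eps

variable (F : Type) [Field F] [NumberField F] (d : F)

/-- **`Eps F d` — the collections `ε = (ε_v)_v`** of [Liu2021, Def. 4.11, second bullet], `v` over the finite places of
`F`, in the normalisation `ε_v ↦ ε_v/δ ∈ F_v^× / Nm_{E_v/F_v} E_v^×` (`E_v = F_v[√d]`, norm group = the tree's
`QuadraticForms.quadraticNormSubgroup (F_v) d = {x² − d y²}`): the product over `v : HeightOneSpectrum (𝓞 F)` of the local
norm class groups (each of order `≤ 2`).  Equality = equality of collections. [cite: Liu2021, Def. 4.11 (l. 2088)] -/
abbrev Eps : Type :=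
  ∀ v : HeightOneSpectrum (𝓞 F),
    (v.adicCompletion F)ˣ ⧸ QuadraticForms.quadraticNormSubgroup (v.adicCompletion F) (algebraMap F (v.adicCompletion F) d)

/-- **the collection of a global `a ∈ F^×`**: `a ↦ (a · Nm_{E_v/F_v} E_v^×)_v` (for `e = a·δ ∈ E^{×−}` this is Liu's
`(e · Nm_{E_v/F_v} E_v^×)_v` in the `δ`-normalisation), a group homomorphism `F^× → Eps F d`.
[cite: Liu2021, Def. 4.12 (l. 2105)] -/
def locF : Fˣ →* Eps F d :=
  MonoidHom.pi fun v =>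
    (QuotientGroup.mk' (QuadraticForms.quadraticNormSubgroup (v.adicCompletion F) (algebraMap F (v.adicCompletion F) d))).comp
      (Units.map (algebraMap F (v.adicCompletion F)).toMonoidHom)

/-- components of `locF a`: the class of `a` in `F_v^× / Nm E_v^×`. [cite: Liu2021, Def. 4.12 (l. 2105)] -/
theorem locF_apply (a : Fˣ) (v : HeightOneSpectrum (𝓞 F)) :
    locF F d a v = (Units.map (algebraMap F (v.adicCompletion F)).toMonoidHom a :
      (v.adicCompletion F)ˣ ⧸ QuadraticForms.quadraticNormSubgroup (v.adicCompletion F) (algebraMap F (v.adicCompletion F) d)) :=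
  rfl

open scoped Classical in
/-- **a global representative `lineOf ε ∈ F^×` of a collection** — some `a` with `locF a = ε` when `ε` is the collection
of a global element (the case of every `μ`-admissible `ε`, Def. 4.12), and the junk value `1` otherwise (never read by a
consumer of [Liu2021, Thm. 4.18], whose index set consists of admissible `ε`).  The hermitian LINE attached to `ε` is
`⟨lineOf ε⟩`; another representative differs by a global element that is a local norm everywhere and gives an isomorphic
line and oscillator representation (Liu's footnote to App. D Step 1, l. 5215). [cite: Liu2021, Def. 4.12 (l. 2102–2108); App. D §D.1 Step 1 footnote (l. 5215)] -/
def lineOf (ε : Eps F d) : Fˣ :=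
  if h : ∃ a : Fˣ, locF F d a = ε then h.choose else 1

/-- `lineOf ε` represents `ε` whenever `ε` is global. [cite: Liu2021, Def. 4.12 (l. 2102–2108)] -/
theorem locF_lineOf {ε : Eps F d} (h : ∃ a : Fˣ, locF F d a = ε) : locF F d (lineOf F d ε) = ε := by
  classical
  unfold lineOf
  rw [dif_pos h]
  exact h.choose_spec

/-- in particular `locF (lineOf (locF a)) = locF a`: the line of the collection of `a` has the same collection as `⟨a⟩`.
[cite: Liu2021, Def. 4.12 (l. 2102–2108)] -/
theorem locF_lineOf_locF (a : Fˣ) : locF F d (lineOf F d (locF F d a)) = locF F d a :=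
  locF_lineOf F d ⟨a, rfl⟩

variable (E : Type) [Field E] [Algebra F E] (δ : E)

/-- the `F`-part `½ · Tr_{E/F}(x)` of `x ∈ E` (for `x ∈ F ⊆ E`, quadratic over `F`, this is `x`). [folklore] -/
def fPart (x : E) : F :=
  (2 : F)⁻¹ * Algebra.trace F E x

/-- `fPart` recovers the elements of `F`: `½ · Tr_{E/F}(a) = a` when `[E : F] = 2` (so `fPart (e/δ) = e/δ` on `E^{×−} = δ·F^×`). [cite: Liu2021, App. D §D.1 Step 1 (l. 5215)] -/
theorem fPart_algebraMap [Algebra.IsQuadraticExtension F E] (a : F) : fPart F E (algebraMap F E a) = a := by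
  rw [fPart, Algebra.trace_algebraMap, Algebra.IsQuadraticExtension.finrank_eq_two]
  have h2 : (2 : F) ≠ 0 := two_ne_zero
  field_simp
  ring

open scoped Classical in
/-- **`epsOf e` — the collection generated by `e`** ([Liu2021, Def. 4.12, first bullet]: «`ε_v = e Nm_{E_v/F_v} E_v^×` for
every nonarchimedean place `v` of `F`»), in the `δ`-normalisation: the classes of the `F`-part of `e/δ` (`= e/δ` for
`e ∈ E^{×−} = δ·F^×`); junk (`1`) when that `F`-part vanishes, in particular the values off `E^{×−}` are never read.
[cite: Liu2021, Def. 4.12 (l. 2105)] -/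
def epsOf (e : E) : Eps F d :=
  if h : fPart F E (e * δ⁻¹) = 0 then 1 else locF F d (Units.mk0 _ h)

/-- **the collection of `e = a·δ`** (`a ∈ F^×`; these are exactly the elements of `E^{×−}`): `epsOf (a·δ) = locF a`.
[cite: Liu2021, Def. 4.12 (l. 2105)] -/
theorem epsOf_algebraMap_mul [Algebra.IsQuadraticExtension F E] (hδ : δ ≠ 0) (a : Fˣ) :
    epsOf F d E δ (algebraMap F E a * δ) = locF F d a := by
  classical
  have hf : fPart F E (algebraMap F E a * δ * δ⁻¹) = a := by
    rw [mul_inv_cancel_right₀ hδ, fPart_algebraMap]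
  unfold epsOf
  rw [dif_neg (by rw [hf]; exact a.ne_zero)]
  congr 1
  exact Units.ext (by rw [Units.val_mk0, hf])

/-- hence admissible collections are global: `∃ a, locF a = epsOf (a·δ)`, and `lineOf` represents them.
[cite: Liu2021, Def. 4.12 (l. 2102–2108)] -/
theorem locF_lineOf_epsOf [Algebra.IsQuadraticExtension F E] (hδ : δ ≠ 0) (a : Fˣ) :
    locF F d (lineOf F d (epsOf F d E δ (algebraMap F E a * δ))) = epsOf F d E δ (algebraMap F E a * δ) :=
  locF_lineOf F d ⟨a, (epsOf_algebraMap_mul F d E δ hδ a).symm⟩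

end Eps

/-! ## §2. `χ`: automorphic characters of `E¹\(𝔸_E^∞)¹`, moved to the unitary group of a line -/

section Chi

variable (F E : Type) [Field F] [NumberField F] [Field E] [NumberField E] [Algebra F E] (c : E ≃ₐ[F] E)

omit [NumberField F] in
/-- **automorphic characters of `E¹\(𝔸_E^∞)¹`** ([Liu2021, Def. 4.11, third bullet]): a character of the norm-one finite
idèles `U(1)(𝔸_{F,f}) = UnitaryGroup.finAdelicOne F E c` that is CONTINUOUS and TRIVIAL on the rational norm-one elements
`E¹ = {x ∈ E^× | c(x)·x = 1}` (embedded diagonally, `x ↦ (x)_w`). [cite: Liu2021, Def. 4.11 (l. 2090)] -/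
def IsAutomorphicOneChar (χ : UnitaryGroup.finAdelicOne F E c →* ℂˣ) : Prop :=
  Continuous χ ∧
    ∀ (x : Eˣ) (hx : Units.map (algebraMap E (FiniteAdeleRing (𝓞 E) E)).toMonoidHom x ∈ UnitaryGroup.finAdelicOne F E c),
      χ ⟨_, hx⟩ = 1

/-- **`Chi F E c` — the index type of the `χ`** of [Liu2021, Def. 4.11 / Thm. 4.18]: automorphic characters of
`E¹\(𝔸_E^∞)¹`, one type for all lines `W`. [cite: Liu2021, Def. 4.11 (l. 2090)] -/
abbrev Chi : Type :=
  {χ : UnitaryGroup.finAdelicOne F E c →* ℂˣ // IsAutomorphicOneChar F E c χ}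

omit [NumberField F] in
/-- the trivial character is automorphic. [cite: Liu2021, Def. 4.11 (l. 2090)] -/
theorem isAutomorphicOneChar_one : IsAutomorphicOneChar F E c 1 :=
  ⟨continuous_const, fun _ _ => rfl⟩

/-- `Chi` is inhabited by the trivial character — the consumer's reading `hChi : Nonempty Chi`.
[cite: Liu2021, Def. 4.11 (l. 2090)] -/
instance instInhabitedChi : Inhabited (Chi F E c) :=
  ⟨⟨1, isAutomorphicOneChar_one F E c⟩⟩

omit [NumberField F] in
/-- `Nonempty Chi` (the shape of the consumer's binder). [cite: Liu2021, Def. 4.11 (l. 2090)] -/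
theorem nonempty_chi : Nonempty (Chi F E c) :=
  inferInstance

/-! ### hermitian lines `⟨a⟩`, `a ∈ F^×`, in the dual-pair lane's convention `J = T.map (algebraMap F E)` -/

/-- Gram matrix `(a)` over `F` of the hermitian line `⟨a⟩`. [cite: Liu2021, App. D §D.1 Step 1 (l. 5215)] -/
def TW (a : Fˣ) : Matrix (Fin 1) (Fin 1) F :=
  !![(a : F)]

/-- Gram matrix `(a)` over `E`. [cite: Liu2021, App. D §D.1 Step 1 (l. 5215)] -/
def JW (a : Fˣ) : Matrix (Fin 1) (Fin 1) E :=
  (TW F a).map (algebraMap F E)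

omit [NumberField F] [NumberField E] in
/-- the lane's hypothesis `hJW` for the line `⟨a⟩`: `J_W = T_W ⊗ 1`. [cite: GelbartRogawski1991, §3.1 p. 454] -/
theorem JW_eq (a : Fˣ) : JW F E a = (TW F a).map (algebraMap F E) := rfl

omit [NumberField F] in
/-- the lane's hypothesis `hW` for the line `⟨a⟩`: a `1 × 1` Gram matrix is symmetric. [cite: GelbartRogawski1991, §3.1 p. 454] -/
theorem isSymm_TW (a : Fˣ) : (TW F a).IsSymm :=
  Matrix.IsSymm.ext fun i j => by rw [Subsingleton.elim i j]

omit [NumberField F] in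
/-- the lane's hypothesis `hWd` for the line `⟨a⟩`: `det (a) = a` is a unit (the line is non-degenerate). [cite: GelbartRogawski1991, §3.1 p. 454] -/
theorem isUnit_det_TW (a : Fˣ) : IsUnit (TW F a).det := by
  rw [Matrix.det_fin_one]
  exact a.isUnit

omit [NumberField F] [NumberField E] in
/-- the entry of `J_W`: `(J_W)₀₀ = a`. [cite: Liu2021, App. D §D.1 Step 1 (l. 5215)] -/
theorem JW_apply (a : Fˣ) : JW F E a 0 0 = algebraMap F E a := rfl

omit [NumberField F] [NumberField E] in
/-- `(J_W)₀₀ ≠ 0` (input of `UnitaryGroup.finAdelicCenter_surjective_one`): the line is non-degenerate. [cite: Liu2021, App. D §D.1 Step 1 (l. 5215)] -/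
theorem JW_apply_ne_zero (a : Fˣ) : JW F E a 0 0 ≠ 0 := by
  rw [JW_apply]
  exact (map_ne_zero (algebraMap F E)).2 a.ne_zero

omit [NumberField F] in
/-- for a line, `u ↦ u·1_1 : U(1)(𝔸_{F,f}) → U(J_W)(𝔸_{F,f})` is injective (the entry of `u·1_1` is `u`).
[cite: Mok2014, §1 Notation p. 5] -/
theorem finAdelicCenter_one_injective (J : Matrix (Fin 1) (Fin 1) E) :
    Function.Injective (UnitaryGroup.finAdelicCenter F E c 1 J) := by
  intro u v h
  apply Subtype.ext
  apply Units.ext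
  have h' := congrArg (fun g : UnitaryGroup.finAdelic F E c 1 J =>
    ((g : GL (Fin 1) (FiniteAdeleRing (𝓞 E) E)) : Matrix (Fin 1) (Fin 1) (FiniteAdeleRing (𝓞 E) E)) 0 0) h
  simpa only [UnitaryGroup.coe_finAdelicCenter, Matrix.smul_apply, Matrix.one_apply_eq, smul_eq_mul, mul_one] using h'

/-- **`U(1)(𝔸_{F,f}) ≃* U(J_W)(𝔸_{F,f})` for the line `W = ⟨a⟩`**: the tree's centre map `u ↦ u·1_W`, bijective for
lines (`UnitaryGroup.finAdelicCenter_surjective_one`). [cite: Mok2014, §1 Notation p. 5] -/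
def lineCenterEquiv (a : Fˣ) : UnitaryGroup.finAdelicOne F E c ≃* UnitaryGroup.finAdelic F E c 1 (JW F E a) :=
  MulEquiv.ofBijective (UnitaryGroup.finAdelicCenter F E c 1 (JW F E a))
    ⟨finAdelicCenter_one_injective F E c _,
      UnitaryGroup.finAdelicCenter_surjective_one F E c (JW F E a) (JW_apply_ne_zero F E a)⟩

omit [NumberField F] in
/-- `lineCenterEquiv a u = u·1_W`. [cite: Mok2014, §1 Notation p. 5] -/
theorem lineCenterEquiv_apply (a : Fˣ) (u : UnitaryGroup.finAdelicOne F E c) :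
    lineCenterEquiv F E c a u = UnitaryGroup.finAdelicCenter F E c 1 (JW F E a) u := rfl

/-- **`χ` read on the line's unitary group**: `χ_W := χ ∘ (u·1_W ↦ u) : U(J_W)(𝔸_{F,f}) →* ℂ^×`, the character by which
`U(W) = E¹(𝔸_f)` is made to act in App. D Step 3. [cite: Liu2021, App. D §D.1 Step 3 (l. 5221)] -/
def lineChar (a : Fˣ) (χ : UnitaryGroup.finAdelicOne F E c →* ℂˣ) : UnitaryGroup.finAdelic F E c 1 (JW F E a) →* ℂˣ :=
  χ.comp (lineCenterEquiv F E c a).symm.toMonoidHom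

omit [NumberField F] in
/-- `χ_W(u·1_W) = χ(u)`. [cite: Liu2021, App. D §D.1 Step 3 (l. 5221)] -/
@[simp] theorem lineChar_finAdelicCenter (a : Fˣ) (χ : UnitaryGroup.finAdelicOne F E c →* ℂˣ)
    (u : UnitaryGroup.finAdelicOne F E c) :
    lineChar F E c a χ (UnitaryGroup.finAdelicCenter F E c 1 (JW F E a) u) = χ u := by
  show χ ((lineCenterEquiv F E c a).symm (lineCenterEquiv F E c a u)) = χ u
  rw [MulEquiv.symm_apply_apply]

end Chi

/-! ## §3. `ω(μ, ε, χ)` and its `𝔾(𝔸_F^∞)`-action: the Weil `χ`-coinvariants of the pair `(V, ⟨lineOf ε⟩)` -/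

section Omega

variable (F E : Type) [Field F] [NumberField F] [Field E] [NumberField E] [Algebra F E]
variable (c : E ≃ₐ[F] E) (N : ℕ) {n : ℕ} (e : Fin N × Fin 1 ≃ Fin n)
variable (JV : Matrix (Fin N) (Fin N) E) {TV : Matrix (Fin N) (Fin N) F}
variable [Algebra.IsQuadraticExtension F E] {δ : E} (hcδ : c δ = -δ) (hδ : δ ≠ 0) {d : F}
  (hd : δ * δ = algebraMap F E d) (hV : TV.IsSymm) (hVd : IsUnit TV.det) (hJV : JV = TV.map (algebraMap F E))
/- THE SPLITTING FAMILY (a parameter, see the module docstring): for every line `⟨a⟩` a compatible, continuous pair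
splitting `s_a : G₁(𝔸_F) = U(J_V ⊗ (a))(𝔸_F) → Mp` of [GelbartRogawski1991, Prop. 3.1.1] — to be instantiated by the
splittings attached to `μ` ([Liu2021, App. D Step 2]). -/
variable {s : ∀ a : Fˣ, UnitaryGroup.adelicPair F E c N 1 JV (JW F E a) →* adelicMpCont F (Fin n) (adelicGram F e TV (TW F a))}
  (hs : ∀ a : Fˣ, (splittingDatum F E c N 1 e JV (JW F E a) hcδ hδ hd hV (isSymm_TW F a) hVd (isUnit_det_TW F a) hJV
    (JW_eq F E a)).IsCompatible (s a))

/-- **`omega … ε χ = ω(μ, ε, χ)`** ([Liu2021, Def. 4.11; App. D §D.1 Steps 1–3]) for the splitting family `s`: the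
`χ_W`-coinvariants `Ω(s_{lineOf ε}, χ_W)` of the finite Weil representation of the finite-adelic dual pair
`U(J_V) × U(⟨lineOf ε⟩)` under the line's unitary group `U(W)(𝔸_{F,f}) = E¹(𝔸_f)` (`TwistedCoinv.Coinv` of
`WeilCoinv.finPairRepW`), a `ℂ`-vector space. [cite: Liu2021, Def. 4.11 (l. 2092–2096); App. D §D.1 Step 3 (l. 5221)] -/
abbrev omega (ε : Eps F d) (χ : Chi F E c) : Type :=
  TwistedCoinv.Coinv
    (finPairRepW F E c N 1 e JV (JW F E (lineOf F d ε)) hcδ hδ hd hV (isSymm_TW F _) hVd (isUnit_det_TW F _) hJV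
      (JW_eq F E _) (hs (lineOf F d ε)))
    (lineChar F E c (lineOf F d ε) χ.1)

/-- **the `U(J_V)(𝔸_{F,f})`-action on `ω(μ, ε, χ)`** (`WeilCoinv.weilCoinv`: `k ↦ ω_f(s_pair(k, 1))` on the coinvariants).
[cite: Liu2021, Def. 4.11 (l. 2092–2096); App. D §D.1 Steps 2–3 (l. 5217–5221)] -/
def rhoV (ε : Eps F d) (χ : Chi F E c) :
    Representation ℂ (UnitaryGroup.finAdelic F E c N JV) (omega F E c N e JV hcδ hδ hd hV hVd hJV hs ε χ) :=
  weilCoinv F E c N 1 e JV (JW F E (lineOf F d ε)) hcδ hδ hd hV (isSymm_TW F _) hVd (isUnit_det_TW F _) hJV (JW_eq F E _)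
    (lineChar F E c (lineOf F d ε) χ.1) (hs (lineOf F d ε))

variable {G : Type*} [Group G] [TopologicalSpace G] (ι : G →* UnitaryGroup.finAdelic F E c N JV)

/-- **`rho … ι ε χ`: the action of `𝔾(𝔸_F^∞) = G` on `ω(μ, ε, χ)`** through the identification
`ι : G →* U(J_V)(𝔸_{F,f})` («FIXES an isomorphism `𝔾(𝔸_F^∞) ≃ G(τ)(𝔸^∞)`», App. C l. 4624) — the field `rho` of the
consumer's `Thm418Rest` / `Thm418Data`. [cite: Liu2021, Def. 4.11 (l. 2092–2096); App. C (l. 4624)] -/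
def rho (ε : Eps F d) (χ : Chi F E c) : Representation ℂ G (omega F E c N e JV hcδ hδ hd hV hVd hJV hs ε χ) :=
  (rhoV F E c N e JV hcδ hδ hd hV hVd hJV hs ε χ).comp ι

omit [TopologicalSpace G] in
/-- unfolding: `rho ι ε χ g = rhoV ε χ (ι g)`. [cite: Liu2021, Def. 4.11 (l. 2092–2096)] -/
theorem rho_apply (ε : Eps F d) (χ : Chi F E c) (g : G) :
    rho F E c N e JV hcδ hδ hd hV hVd hJV hs ι ε χ g = rhoV F E c N e JV hcδ hδ hd hV hVd hJV hs ε χ (ι g) := rfl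

/-- **`ω(μ, ε, χ)` IS SMOOTH** — every vector is fixed by an open subgroup of `G` — for `ι` continuous and the pair
splittings continuous: the consumer's reading `hsm` of «admissible» ([Liu2021, Def. 4.11]) TOKEN FOR TOKEN, from the
tree's `WeilCoinv.weilCoinv_comp_smooth` ([Weil1964, n° 39] level fixing + [MVW87, Chap. 2 II.2]).
[cite: Liu2021, Def. 4.11 (l. 2096)] -/
theorem rho_smooth (hι : Continuous ι) (hsc : ∀ a : Fˣ, Continuous (pairSplitting F E c N 1 e JV (JW F E a) (s a)))
    (ε : Eps F d) (χ : Chi F E c) (v : omega F E c N e JV hcδ hδ hd hV hVd hJV hs ε χ) :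
    ∃ S : Subgroup G, IsOpen (S : Set G) ∧ ∀ k ∈ S, rho F E c N e JV hcδ hδ hd hV hVd hJV hs ι ε χ k v = v :=
  weilCoinv_comp_smooth F E c N 1 e JV (JW F E (lineOf F d ε)) hcδ hδ hd hV (isSymm_TW F _) hVd (isUnit_det_TW F _) hJV
    (JW_eq F E _) (lineChar F E c (lineOf F d ε) χ.1) ι hι (hsc _) (hs _) v

/-- the same in `Representation.IsSmooth`-free wording for the un-pulled-back action (`ι = id`).
[cite: Liu2021, Def. 4.11 (l. 2096)] -/
theorem rhoV_smooth (hsc : ∀ a : Fˣ, Continuous (pairSplitting F E c N 1 e JV (JW F E a) (s a)))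
    (ε : Eps F d) (χ : Chi F E c) (v : omega F E c N e JV hcδ hδ hd hV hVd hJV hs ε χ) :
    ∃ S : Subgroup (UnitaryGroup.finAdelic F E c N JV), IsOpen (S : Set (UnitaryGroup.finAdelic F E c N JV)) ∧
      ∀ k ∈ S, rhoV F E c N e JV hcδ hδ hd hV hVd hJV hs ε χ k v = v :=
  rho_smooth F E c N e JV hcδ hδ hd hV hVd hJV hs (MonoidHom.id _) continuous_id hsc ε χ v

/-- **CENTRAL CHARACTER `χ`** ([Liu2021, App. D §D.1 Step 3] «the maximal quotient … with central character `χ`»): the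
centre `u·1_V` of `U(J_V)(𝔸_{F,f})` acts on `ω(μ, ε, χ)` by `χ(u)` — because inside `G₁ = U(J_V ⊗ J_W)` the elements
`u·1_V ⊗ 1` and `1 ⊗ u·1_W` coincide (`WeilCoinv.weilCoinv_finAdelicCenter`). [cite: Liu2021, App. D §D.1 Step 3 (l. 5221)] -/
theorem rhoV_finAdelicCenter (ε : Eps F d) (χ : Chi F E c) (u : UnitaryGroup.finAdelicOne F E c)
    (x : omega F E c N e JV hcδ hδ hd hV hVd hJV hs ε χ) :
    rhoV F E c N e JV hcδ hδ hd hV hVd hJV hs ε χ (UnitaryGroup.finAdelicCenter F E c N JV u) x = ((χ.1 u : ℂˣ) : ℂ) • x := by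
  rw [rhoV, weilCoinv_finAdelicCenter, lineChar_finAdelicCenter]

/-- the generators of `ω(μ, ε, χ)`: classes `[f]` of finite Schwartz–Bruhat functions, on which `U(W)` acts by `χ_W`
(`[ω_f(s_pair(1,u)) f] = χ_W(u) • [f]`). [cite: Liu2021, App. D §D.1 Step 3 (l. 5221)] -/
theorem mk_finPairRep_one_eq_smul (ε : Eps F d) (χ : Chi F E c)
    (u : UnitaryGroup.finAdelic F E c 1 (JW F E (lineOf F d ε))) (f : FinSB F (Fin N × Fin 1)) :
    (TwistedCoinv.mk _ (lineChar F E c (lineOf F d ε) χ.1)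
        (finPairRep F E c N 1 e JV (JW F E (lineOf F d ε)) hcδ hδ hd hV (isSymm_TW F _) hVd (isUnit_det_TW F _) hJV
          (JW_eq F E _) (hs (lineOf F d ε)) (1, u) f) : omega F E c N e JV hcδ hδ hd hV hVd hJV hs ε χ) =
      ((lineChar F E c (lineOf F d ε) χ.1 u : ℂˣ) : ℂ) • TwistedCoinv.mk _ _ f :=
  mk_finPairRep_one F E c N 1 e JV (JW F E (lineOf F d ε)) hcδ hδ hd hV (isSymm_TW F _) hVd (isUnit_det_TW F _) hJV
    (JW_eq F E _) (lineChar F E c (lineOf F d ε) χ.1) (hs (lineOf F d ε)) u f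

end Omega

/-! ## §4. The same carriers under a FAMILY OF CITED EXISTENTIALS `hGR` ([GelbartRogawski1991, Prop. 3.1.1] for
`G₁ = U(J_V ⊗ (a))`, every line `a`): the splitting CHOSEN by the lane (`UnitaryDualPair.splittingOf = Exists.choose`)

MODEL-CHOICE VARIANT.  This is the shape in which a consumer's display carries ONE cited binder `hGR` in place of the
posited `ω`-carriers; it does NOT record the attachment of the splitting to `μ` (module docstring: two compatible
splittings differ by an automorphic `ν ∘ det`, twisting the family by `ν ∘ det_V`) — the parametric `omega`/`rho` of §3 do.
Smoothness and the central character hold for ANY choice. -/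

section GR

variable (F E : Type) [Field F] [NumberField F] [Field E] [NumberField E] [Algebra F E]
variable (c : E ≃ₐ[F] E) (N : ℕ) {n : ℕ} (e : Fin N × Fin 1 ≃ Fin n)
variable (JV : Matrix (Fin N) (Fin N) E) {TV : Matrix (Fin N) (Fin N) F}
variable [Algebra.IsQuadraticExtension F E] {δ : E} (hcδ : c δ = -δ) (hδ : δ ≠ 0) {d : F}
  (hd : δ * δ = algebraMap F E d) (hV : TV.IsSymm) (hVd : IsUnit TV.det) (hJV : JV = TV.map (algebraMap F E))
variable (hGR : ∀ a : Fˣ, (splittingDatum F E c N 1 e JV (JW F E a) hcδ hδ hd hV (isSymm_TW F a) hVd (isUnit_det_TW F a)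
    hJV (JW_eq F E a)).CompatibleSplitting)

/-- the chosen splittings are compatible, line by line. [cite: GelbartRogawski1991, §3.1 Prop. 3.1.1 p. 455 L1–3] -/
theorem isCompatible_splittingOf_lines (a : Fˣ) :
    (splittingDatum F E c N 1 e JV (JW F E a) hcδ hδ hd hV (isSymm_TW F a) hVd (isUnit_det_TW F a) hJV
        (JW_eq F E a)).IsCompatible
      (splittingOf F E c N 1 e JV (JW F E a) hcδ hδ hd hV (isSymm_TW F a) hVd (isUnit_det_TW F a) hJV (JW_eq F E a)
        (hGR a)) :=
  splittingOf_isCompatible F E c N 1 e JV (JW F E a) hcδ hδ hd hV (isSymm_TW F a) hVd (isUnit_det_TW F a) hJV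
    (JW_eq F E a) (hGR a)

/-- the chosen pair splittings are continuous, line by line. [cite: GelbartRogawski1991, §3.1 Prop. 3.1.1 p. 455 L1–3] -/
theorem continuous_pairSplitting_splittingOf_lines (a : Fˣ) :
    Continuous (pairSplitting F E c N 1 e JV (JW F E a)
      (splittingOf F E c N 1 e JV (JW F E a) hcδ hδ hd hV (isSymm_TW F a) hVd (isUnit_det_TW F a) hJV (JW_eq F E a)
        (hGR a))) :=
  continuous_pairSplitting_splittingOf F E c N 1 e JV (JW F E a) hcδ hδ hd hV (isSymm_TW F a) hVd (isUnit_det_TW F a)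
    hJV (JW_eq F E a) (hGR a)

/-- **`omegaGR … hGR ε χ`**: `ω(μ, ε, χ)` for the CHOSEN splittings (`omega` of §3 at `s a := splittingOf … (hGR a)`).
[cite: Liu2021, Def. 4.11 (l. 2092–2096); App. D §D.1 Step 3 (l. 5221)] -/
abbrev omegaGR (ε : Eps F d) (χ : Chi F E c) : Type :=
  omega F E c N e JV hcδ hδ hd hV hVd hJV (isCompatible_splittingOf_lines F E c N e JV hcδ hδ hd hV hVd hJV hGR) ε χ

/-- its `U(J_V)(𝔸_{F,f})`-action. [cite: Liu2021, Def. 4.11 (l. 2092–2096); App. D §D.1 Steps 2–3 (l. 5217–5221)] -/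
def rhoVGR (ε : Eps F d) (χ : Chi F E c) :
    Representation ℂ (UnitaryGroup.finAdelic F E c N JV) (omegaGR F E c N e JV hcδ hδ hd hV hVd hJV hGR ε χ) :=
  rhoV F E c N e JV hcδ hδ hd hV hVd hJV (isCompatible_splittingOf_lines F E c N e JV hcδ hδ hd hV hVd hJV hGR) ε χ

variable {G : Type*} [Group G] [TopologicalSpace G] (ι : G →* UnitaryGroup.finAdelic F E c N JV)

/-- **`rhoGR … hGR ι ε χ`**: the `G`-action on `ω(μ, ε, χ)` for the chosen splittings, through `ι`.
[cite: Liu2021, Def. 4.11 (l. 2092–2096); App. C (l. 4624)] -/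
def rhoGR (ε : Eps F d) (χ : Chi F E c) : Representation ℂ G (omegaGR F E c N e JV hcδ hδ hd hV hVd hJV hGR ε χ) :=
  rho F E c N e JV hcδ hδ hd hV hVd hJV (isCompatible_splittingOf_lines F E c N e JV hcδ hδ hd hV hVd hJV hGR) ι ε χ

/-- **smoothness for the chosen splittings** (`hsm` under the single cited binder `hGR` + continuity of `ι`).
[cite: Liu2021, Def. 4.11 (l. 2096)] -/
theorem rhoGR_smooth (hι : Continuous ι) (ε : Eps F d) (χ : Chi F E c)
    (v : omegaGR F E c N e JV hcδ hδ hd hV hVd hJV hGR ε χ) :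
    ∃ S : Subgroup G, IsOpen (S : Set G) ∧ ∀ k ∈ S, rhoGR F E c N e JV hcδ hδ hd hV hVd hJV hGR ι ε χ k v = v :=
  rho_smooth F E c N e JV hcδ hδ hd hV hVd hJV (isCompatible_splittingOf_lines F E c N e JV hcδ hδ hd hV hVd hJV hGR)
    ι hι (continuous_pairSplitting_splittingOf_lines F E c N e JV hcδ hδ hd hV hVd hJV hGR) ε χ v

omit [TopologicalSpace G] in
/-- **central character `χ` for the chosen splittings.** [cite: Liu2021, App. D §D.1 Step 3 (l. 5221)] -/
theorem rhoVGR_finAdelicCenter (ε : Eps F d) (χ : Chi F E c) (u : UnitaryGroup.finAdelicOne F E c)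
    (x : omegaGR F E c N e JV hcδ hδ hd hV hVd hJV hGR ε χ) :
    rhoVGR F E c N e JV hcδ hδ hd hV hVd hJV hGR ε χ (UnitaryGroup.finAdelicCenter F E c N JV u) x =
      ((χ.1 u : ℂˣ) : ℂ) • x :=
  rhoV_finAdelicCenter F E c N e JV hcδ hδ hd hV hVd hJV
    (isCompatible_splittingOf_lines F E c N e JV hcδ hδ hd hV hVd hJV hGR) ε χ u x

end GR

end Literature.NumberTheory.Automorphic.Liu2021.Def411WeilCarriers

end
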